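import Summits.BirchSwinnertonDyer.BirchSwinnertonDyer.Theorems.ClassRecordThreeCornerAtThreeMilneTamagawaLangNeron
import Summits.BirchSwinnertonDyer.BirchSwinnertonDyer.Theorems.ClassRecordThreeCornerAtThreeMilneTamagawaHerbrand
import Summits.BirchSwinnertonDyer.Rank1Residual.X11b.BDPRouteLocalNonsingularBridge
import Literature.NumberTheory.EllipticCurves.KodairaNeronUnramifiedProofs
import Literature.NumberTheory.EllipticCurves.TateNormalFormUnramifiedComponentsProofs
import Literature.NumberTheory.EllipticCurves.IwasawaSelmerControlAwayFromPProofs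
import HarnessLib

/-!
# Milne *ADT* I Prop. 3.8 in the kernel, part 5b: THE ASSEMBLY in model currency — at a place of bad reduction, `c_v` times an
# unramified crossed homomorphism `Γ_{K_v} → V(K̄_v)` with open zero set is a coboundary
# (cell `bsd-stepL`, seat `bsd-stepL-corner3-p2` g10 = WIDTH-LEVER lane B; toward the DISCHARGE of the cite-only Literature fact
# `Milne2006_localTamagawaNumber_smul_unramifiedClass_eq_zero` (tam3-p1 g15, p614601); `--supports stmt-BirchSwinnertonDyer-21420 --as helper`)

`exists_localTamagawaNumber_nsmul_eq_map_sub_of_bad`: for `W/K` elliptic with MULTIPLICATIVE or ADDITIVE reduction at `v`, `V = M ⊗ K̄_v`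
the minimal model, and a crossed homomorphism `g : Γ_{K_v} → V(K̄_v)` with open zero set vanishing on the inertia group `I_𝔐`, there is
`P ∈ V(K̄_v)` with `c_v • g σ = σ P − P` for all `σ`, `c_v = (W ⊗ K_v).localTamagawaNumber 𝓞_v`. Proof (Milne I Prop. 3.8): `F` an
arithmetic Frobenius; `N = V(K̄_v)^{I_𝔐} ⊇ N₀ =` its points of nonsingular reduction on the `𝒪_w`-model; `Φ̃ = N/N₀` is FINITE
(Kodaira–Néron over `K_v^{nr}`, tree `kodairaNeron_exists_finset_reducesToNonsingular_holds`) with the Frobenius automorphism `φ̄`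
(`E₀` is Galois-stable: `reducesToNonsingular_map_iff_of_forall_eq`); `#Φ̃^{φ̄} = c_v` by the LANG–NÉRON surjectivity (part 4) + Galois
descent + n1011's `localTamagawaNumber_eq_index_nonsingularReductionSubgroup` ∕ `hasNonsingularReduction_algebraMap_iff`; the value
`a = g F ∈ N` has vanishing norm `Σ_{j<m} F^j a = g(F^m) = 0` for `m` with `F^m` in the open zero set and `φ̄^m = 1`; the Herbrand
count (part 5a) gives `c_v • a = (F Q − Q) + e` with `Q ∈ N`, `e ∈ N₀`; then `g′ = c_v g − ∂Q` is an unramified crossed homomorphism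
with open zero set and `g′ F = e ∈ E₀`, so the located Step 1 (parts 1–2) and Steps 2–4 (part 3) give `g′ = ∂P′`.
HONEST FRAMING: one theorem; no definition, no named fact, no `sorry`; nothing about BSD, no stub closes, no item is credited (T7).
Credit: x11b3-p8 (E₀-valued vanishing machinery), n1011 (local bridges), the tree (Kodaira–Néron over `K^nr`, Frobenius generation).
References: [cite: MilneADT2006, Ch. I Prop. 3.8] [cite: SerreLocalFields1979, VIII §4, XIII §1] [cite: SilvermanAEC2009, VII §2 Prop. 2.1, VII §6 Thm. 6.1, Ex. 7.6]
[cite: SilvermanATAEC1994, IV Cor. 9.2].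
-/

set_option linter.dupNamespace false
set_option autoImplicit false

noncomputable section

open scoped Classical NNReal Topology
open NumberField IsDedekindDomain Field

universe u

namespace Summit.BirchSwinnertonDyer.BirchSwinnertonDyer.Theorems.MilneTamagawa

open WeierstrassCurve Literature.NumberTheory.EllipticCurves
  Literature.NumberTheory.EllipticCurves.FormalGroupChart
  Literature.NumberTheory.GaloisRepresentations
  Literature.NumberTheory.GaloisRepresentations.IsNonarchimedeanLocalField IsDedekindDomain.HeightOneSpectrum
  Summit.BirchSwinnertonDyer.Rank1Residual.X11b.Three.UnramifiedNode
  Summit.BirchSwinnertonDyer.Rank1Residual.X11b.AcSelmer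

variable {K : Type u} [Field K] [NumberField K] (W : WeierstrassCurve K) {v : HeightOneSpectrum (𝓞 K)}
  {w : Valuation (AlgebraicClosure (v.adicCompletion K)) ℝ≥0}
  (hw : ∀ x, (w x : ℝ) = spectralNorm (v.adicCompletion K) (AlgebraicClosure (v.adicCompletion K)) x)
  {ι : v.adicCompletionIntegers K →+* w.integer}
  (hι : ∀ a, ((ι a : w.integer) : AlgebraicClosure (v.adicCompletion K)) =
    algebraMap (v.adicCompletion K) (AlgebraicClosure (v.adicCompletion K)) (a : v.adicCompletion K))

include hw hι in
set_option maxHeartbeats 3200000 in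
/-- **Milne *ADT* I Prop. 3.8 (model currency, bad reduction): `c_v` times an unramified crossed homomorphism with open zero set is a
coboundary.** See the module docstring for the proof. [cite: MilneADT2006, Ch. I Prop. 3.8] [cite: SilvermanATAEC1994, IV Cor. 9.2]
[cite: SerreLocalFields1979, VIII §4 Prop. 8, XIII §1 Prop. 1] -/
theorem exists_localTamagawaNumber_nsmul_eq_map_sub_of_bad [W.IsElliptic]
    (hbad : W.HasMultiplicativeReductionAt v ∨ W.HasAdditiveReductionAt v)
    {𝔐 : Ideal v.localAbsIntegers} (h𝔐 : 𝔐 ∈ v.localPrimesAbove)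
    [hV : (((W.localMinimalIntegralModel v).map (algebraMap (v.adicCompletionIntegers K) (v.adicCompletion K))).baseChange (AlgebraicClosure (v.adicCompletion K))).IsIntegral w.integer]
    (g : absoluteGaloisGroup (v.adicCompletion K) → ((((W.localMinimalIntegralModel v).map (algebraMap (v.adicCompletionIntegers K) (v.adicCompletion K))).baseChange (AlgebraicClosure (v.adicCompletion K)))).toAffine.Point)
    (hg : ∀ σ τ, g (σ * τ) = g σ + WeierstrassCurve.Affine.Point.map (W' := (W.localMinimalIntegralModel v).map (algebraMap (v.adicCompletionIntegers K) (v.adicCompletion K))) ((absoluteGaloisGroup.toAlgEquiv (v.adicCompletion K) (σ) : AlgebraicClosure (v.adicCompletion K) ≃ₐ[v.adicCompletion K] AlgebraicClosure (v.adicCompletion K)) : AlgebraicClosure (v.adicCompletion K) →ₐ[v.adicCompletion K] AlgebraicClosure (v.adicCompletion K)) (g τ))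
    (hopen : IsOpen {σ | g σ = 0})
    (hI : ∀ τ ∈ 𝔐.inertia (absoluteGaloisGroup (v.adicCompletion K)), g τ = 0) :
    ∃ P : ((((W.localMinimalIntegralModel v).map (algebraMap (v.adicCompletionIntegers K) (v.adicCompletion K))).baseChange (AlgebraicClosure (v.adicCompletion K)))).toAffine.Point, ∀ σ,
      ((W.baseChange (v.adicCompletion K)).localTamagawaNumber (v.adicCompletionIntegers K)) • g σ =
        WeierstrassCurve.Affine.Point.map (W' := (W.localMinimalIntegralModel v).map (algebraMap (v.adicCompletionIntegers K) (v.adicCompletion K))) ((absoluteGaloisGroup.toAlgEquiv (v.adicCompletion K) (σ) : AlgebraicClosure (v.adicCompletion K) ≃ₐ[v.adicCompletion K] AlgebraicClosure (v.adicCompletion K)) : AlgebraicClosure (v.adicCompletion K) →ₐ[v.adicCompletion K] AlgebraicClosure (v.adicCompletion K)) P - P := by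
  have hvw : w.Integers w.integer := Valuation.integer.integers w
  haveI hXell : ((W.localMinimalIntegralModel v).map (algebraMap (v.adicCompletionIntegers K) (v.adicCompletion K))).IsElliptic :=
    W.isElliptic_map_localMinimalIntegralModel (v := v)
  haveI hXmin : ((W.localMinimalIntegralModel v).map (algebraMap (v.adicCompletionIntegers K) (v.adicCompletion K))).IsMinimal
      (v.adicCompletionIntegers K) := W.isMinimal_map_localMinimalIntegralModel (v := v)
  haveI hInormal : (𝔐.inertia (absoluteGaloisGroup (v.adicCompletion K))).Normal := inertia_normal_of_mem_localPrimesAbove v h𝔐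
  have hX : (((W.localMinimalIntegralModel v).map (algebraMap (v.adicCompletionIntegers K) (v.adicCompletion K))).baseChange (AlgebraicClosure (v.adicCompletion K))) =
      ((W.localMinimalIntegralModel v).map ι).baseChange (AlgebraicClosure (v.adicCompletion K)) :=
    baseChange_map_eq_baseChange_map hι (W.localMinimalIntegralModel v)
  -- a Frobenius and the isometries
  obtain ⟨F, hF⟩ := exists_isArithFrobAt_localAbsIntegers (v := v) h𝔐
  have hσw : ∀ (σ : absoluteGaloisGroup (v.adicCompletion K)) (z : AlgebraicClosure (v.adicCompletion K)),
      w ((absoluteGaloisGroup.toAlgEquiv (v.adicCompletion K)) σ z) = w z := fun σ z ↦ spectralValuation_smul hw σ z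
  -- `E₀` on the `𝒪_w`-model, as a subgroup, and its Galois stability
  set N₀ : AddSubgroup ((((W.localMinimalIntegralModel v).map (algebraMap (v.adicCompletionIntegers K) (v.adicCompletion K))).baseChange (AlgebraicClosure (v.adicCompletion K)))).toAffine.Point :=
    (((W.localMinimalIntegralModel v).map ι).nonsingularReductionSubgroup hvw).comap
      (Affine.Point.congrEquiv hX).toAddMonoidHom with hN₀def
  have hN₀ : ∀ P, P ∈ N₀ ↔ ((W.localMinimalIntegralModel v).map ι).HasNonsingularReduction
        (Affine.Point.congrEquiv (baseChange_map_eq_baseChange_map hι (W.localMinimalIntegralModel v)) (P)) := fun P ↦ Iff.rfl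
  have hRTN : ∀ P : ((((W.localMinimalIntegralModel v).map (algebraMap (v.adicCompletionIntegers K) (v.adicCompletion K))).baseChange (AlgebraicClosure (v.adicCompletion K)))).toAffine.Point, P ∈ N₀ ↔
      ReducesToNonsingular w (IsLocalRing.residue w.integer) P := fun P ↦ by
    rw [hN₀, ← reducesToNonsingular_iff_hasNonsingularReduction, reducesToNonsingular_congrEquiv_iff _ _ hX]
  have hstab : ∀ (σ : absoluteGaloisGroup (v.adicCompletion K)) (P : ((((W.localMinimalIntegralModel v).map (algebraMap (v.adicCompletionIntegers K) (v.adicCompletion K))).baseChange (AlgebraicClosure (v.adicCompletion K)))).toAffine.Point),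
      WeierstrassCurve.Affine.Point.map (W' := (W.localMinimalIntegralModel v).map (algebraMap (v.adicCompletionIntegers K) (v.adicCompletion K))) ((absoluteGaloisGroup.toAlgEquiv (v.adicCompletion K) (σ) : AlgebraicClosure (v.adicCompletion K) ≃ₐ[v.adicCompletion K] AlgebraicClosure (v.adicCompletion K)) : AlgebraicClosure (v.adicCompletion K) →ₐ[v.adicCompletion K] AlgebraicClosure (v.adicCompletion K)) P ∈ N₀ ↔ P ∈ N₀ := fun σ P ↦ by
    rw [hRTN, hRTN]
    exact reducesToNonsingular_map_iff_of_forall_eq _ _ (hσw σ) P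
  -- `N = V(K̄_v)^{I}`
  set N : AddSubgroup ((((W.localMinimalIntegralModel v).map (algebraMap (v.adicCompletionIntegers K) (v.adicCompletion K))).baseChange (AlgebraicClosure (v.adicCompletion K)))).toAffine.Point :=
    { carrier := {P | ∀ τ ∈ 𝔐.inertia (absoluteGaloisGroup (v.adicCompletion K)), WeierstrassCurve.Affine.Point.map (W' := (W.localMinimalIntegralModel v).map (algebraMap (v.adicCompletionIntegers K) (v.adicCompletion K))) ((absoluteGaloisGroup.toAlgEquiv (v.adicCompletion K) (τ) : AlgebraicClosure (v.adicCompletion K) ≃ₐ[v.adicCompletion K] AlgebraicClosure (v.adicCompletion K)) : AlgebraicClosure (v.adicCompletion K) →ₐ[v.adicCompletion K] AlgebraicClosure (v.adicCompletion K)) P = P}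
      zero_mem' := fun τ _ ↦ by rw [map_zero]
      add_mem' := fun {a b} ha hb τ hτ ↦ by
        simp only [Set.mem_setOf_eq] at ha hb
        rw [map_add, ha τ hτ, hb τ hτ]
      neg_mem' := fun {a} ha τ hτ ↦ by
        simp only [Set.mem_setOf_eq] at ha
        rw [map_neg, ha τ hτ] } with hNdef
  have hNmem : ∀ P, P ∈ N ↔ ∀ τ ∈ 𝔐.inertia (absoluteGaloisGroup (v.adicCompletion K)), WeierstrassCurve.Affine.Point.map (W' := (W.localMinimalIntegralModel v).map (algebraMap (v.adicCompletionIntegers K) (v.adicCompletion K))) ((absoluteGaloisGroup.toAlgEquiv (v.adicCompletion K) (τ) : AlgebraicClosure (v.adicCompletion K) ≃ₐ[v.adicCompletion K] AlgebraicClosure (v.adicCompletion K)) : AlgebraicClosure (v.adicCompletion K) →ₐ[v.adicCompletion K] AlgebraicClosure (v.adicCompletion K)) P = P :=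
    fun _ ↦ Iff.rfl
  have hNF : ∀ P ∈ N, WeierstrassCurve.Affine.Point.map (W' := (W.localMinimalIntegralModel v).map (algebraMap (v.adicCompletionIntegers K) (v.adicCompletion K))) ((absoluteGaloisGroup.toAlgEquiv (v.adicCompletion K) (F) : AlgebraicClosure (v.adicCompletion K) ≃ₐ[v.adicCompletion K] AlgebraicClosure (v.adicCompletion K)) : AlgebraicClosure (v.adicCompletion K) →ₐ[v.adicCompletion K] AlgebraicClosure (v.adicCompletion K)) P ∈ N := by
    intro P hP τ hτ
    have hτ' : F⁻¹ * τ * F ∈ 𝔐.inertia (absoluteGaloisGroup (v.adicCompletion K)) := by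
      have := hInormal.conj_mem τ hτ F⁻¹
      rwa [inv_inv] at this
    rw [← map_gal_mul, show τ * F = F * (F⁻¹ * τ * F) by group, map_gal_mul, hP _ hτ']
  -- the Frobenius endomorphism of `N` and of `Φ̃ = N / N₀`
  set galF : ((((W.localMinimalIntegralModel v).map (algebraMap (v.adicCompletionIntegers K) (v.adicCompletion K))).baseChange (AlgebraicClosure (v.adicCompletion K)))).toAffine.Point →+ ((((W.localMinimalIntegralModel v).map (algebraMap (v.adicCompletionIntegers K) (v.adicCompletion K))).baseChange (AlgebraicClosure (v.adicCompletion K)))).toAffine.Point :=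
    WeierstrassCurve.Affine.Point.map (W' := (W.localMinimalIntegralModel v).map (algebraMap (v.adicCompletionIntegers K) (v.adicCompletion K))) ((absoluteGaloisGroup.toAlgEquiv (v.adicCompletion K) (F) : AlgebraicClosure (v.adicCompletion K) ≃ₐ[v.adicCompletion K] AlgebraicClosure (v.adicCompletion K)) : AlgebraicClosure (v.adicCompletion K) →ₐ[v.adicCompletion K] AlgebraicClosure (v.adicCompletion K)) with hgalF
  set φN : N →+ N := (galF.comp N.subtype).codRestrict N (fun P ↦ hNF P P.2) with hφN
  have hφN_coe : ∀ P : N, ((φN P : N) : ((((W.localMinimalIntegralModel v).map (algebraMap (v.adicCompletionIntegers K) (v.adicCompletion K))).baseChange (AlgebraicClosure (v.adicCompletion K)))).toAffine.Point) = galF P := fun _ ↦ rfl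
  set L : AddSubgroup N := N₀.addSubgroupOf N with hLdef
  have hLφ : L ≤ L.comap φN := by
    intro P hP
    rw [AddSubgroup.mem_comap, hLdef, AddSubgroup.mem_addSubgroupOf, hφN_coe]
    exact (hstab F _).mpr hP
  set φ : N ⧸ L →+ N ⧸ L := QuotientAddGroup.map L L φN hLφ with hφdef
  have hφmk : ∀ P : N, φ (QuotientAddGroup.mk P) = QuotientAddGroup.mk (φN P) := fun _ ↦ rfl
  -- iterates
  have hφN_iter : ∀ (j : ℕ) (P : N), ((φN^[j] P : N) : ((((W.localMinimalIntegralModel v).map (algebraMap (v.adicCompletionIntegers K) (v.adicCompletion K))).baseChange (AlgebraicClosure (v.adicCompletion K)))).toAffine.Point) = WeierstrassCurve.Affine.Point.map (W' := (W.localMinimalIntegralModel v).map (algebraMap (v.adicCompletionIntegers K) (v.adicCompletion K))) ((absoluteGaloisGroup.toAlgEquiv (v.adicCompletion K) (F ^ j) : AlgebraicClosure (v.adicCompletion K) ≃ₐ[v.adicCompletion K] AlgebraicClosure (v.adicCompletion K)) : AlgebraicClosure (v.adicCompletion K) →ₐ[v.adicCompletion K] AlgebraicClosure (v.adicCompletion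 K)) (P : ((((W.localMinimalIntegralModel v).map (algebraMap (v.adicCompletionIntegers K) (v.adicCompletion K))).baseChange (AlgebraicClosure (v.adicCompletion K)))).toAffine.Point) := by
    intro j
    induction j with
    | zero => intro P; rw [Function.iterate_zero, id_eq, pow_zero, map_gal_one]
    | succ j ih => intro P; rw [Function.iterate_succ_apply', hφN_coe, ih, hgalF, ← map_gal_mul, pow_succ']
  have hφ_iter : ∀ (j : ℕ) (P : N), φ^[j] (QuotientAddGroup.mk P) = QuotientAddGroup.mk (φN^[j] P) := by
    intro j
    induction j with
    | zero => intro P; rfl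
    | succ j ih => intro P; rw [Function.iterate_succ_apply', ih, hφmk, Function.iterate_succ_apply']
  -- `Φ̃` is finite (Kodaira–Néron over `K_v^{nr}`)
  haveI hfin : Finite (N ⧸ L) := by
    obtain ⟨T, hTI, hT⟩ := (kodairaNeron_exists_finset_reducesToNonsingular_holds
      (X := (W.localMinimalIntegralModel v).map (algebraMap (v.adicCompletionIntegers K) (v.adicCompletion K)))) w hw h𝔐
    have hTN : ∀ t ∈ T, t ∈ N := fun t ht ↦ hTI t ht
    let f : T → N ⧸ L := fun t ↦ QuotientAddGroup.mk ⟨t.1, hTN t.1 t.2⟩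
    refine Finite.of_surjective f fun x ↦ ?_
    induction x using QuotientAddGroup.induction_on with
    | H P =>
      obtain ⟨t, ht, hPt⟩ := hT (P : ((((W.localMinimalIntegralModel v).map (algebraMap (v.adicCompletionIntegers K) (v.adicCompletion K))).baseChange (AlgebraicClosure (v.adicCompletion K)))).toAffine.Point) P.2
      refine ⟨⟨t, ht⟩, ?_⟩
      change QuotientAddGroup.mk _ = QuotientAddGroup.mk P
      rw [QuotientAddGroup.eq, hLdef, AddSubgroup.mem_addSubgroupOf]
      have hmem : (P : ((((W.localMinimalIntegralModel v).map (algebraMap (v.adicCompletionIntegers K) (v.adicCompletion K))).baseChange (AlgebraicClosure (v.adicCompletion K)))).toAffine.Point) - t ∈ N₀ := (hRTN _).mpr hPt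
      have : (((-⟨t, hTN t ht⟩ + P : N) : N) : ((((W.localMinimalIntegralModel v).map (algebraMap (v.adicCompletionIntegers K) (v.adicCompletion K))).baseChange (AlgebraicClosure (v.adicCompletion K)))).toAffine.Point) = (P : ((((W.localMinimalIntegralModel v).map (algebraMap (v.adicCompletionIntegers K) (v.adicCompletion K))).baseChange (AlgebraicClosure (v.adicCompletion K)))).toAffine.Point) - t := by
        simp only [AddSubgroup.coe_add, AddSubgroup.coe_neg]; abel
      rw [this]; exact hmem
  -- `φ` is injective, hence a permutation of finite order
  have hφinj : Function.Injective φ := by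
    intro x y hxy
    induction x using QuotientAddGroup.induction_on with
    | H P =>
      induction y using QuotientAddGroup.induction_on with
      | H Q =>
        rw [hφmk, hφmk, QuotientAddGroup.eq, hLdef, AddSubgroup.mem_addSubgroupOf] at hxy
        rw [QuotientAddGroup.eq, hLdef, AddSubgroup.mem_addSubgroupOf]
        have h1 : (((-φN P + φN Q : N) : N) : ((((W.localMinimalIntegralModel v).map (algebraMap (v.adicCompletionIntegers K) (v.adicCompletion K))).baseChange (AlgebraicClosure (v.adicCompletion K)))).toAffine.Point) = galF ((( -P + Q : N) : N) : ((((W.localMinimalIntegralModel v).map (algebraMap (v.adicCompletionIntegers K) (v.adicCompletion K))).baseChange (AlgebraicClosure (v.adicCompletion K)))).toAffine.Point) := by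
          simp only [AddSubgroup.coe_add, AddSubgroup.coe_neg, hφN_coe, map_add, map_neg]
        rw [h1] at hxy
        exact (hstab F _).mp hxy
  have hφbij : Function.Bijective φ := Finite.injective_iff_bijective.mp hφinj
  obtain ⟨r, hrpos, hr⟩ : ∃ r : ℕ, 0 < r ∧ ∀ x, φ^[r] x = x := by
    let e : Equiv.Perm (N ⧸ L) := Equiv.ofBijective φ hφbij
    refine ⟨orderOf e, (isOfFinOrder_of_finite e).orderOf_pos, fun x ↦ ?_⟩
    have h1 : (e ^ orderOf e) x = x := by rw [pow_orderOf_eq_one]; rfl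
    rwa [Equiv.Perm.coe_pow] at h1
  -- the value `a = g F` lies in `N`
  have haN : g F ∈ N := by
    intro τ hτ
    have hτ' : F⁻¹ * τ * F ∈ 𝔐.inertia (absoluteGaloisGroup (v.adicCompletion K)) := by
      have := hInormal.conj_mem τ hτ F⁻¹
      rwa [inv_inv] at this
    have h1 : g (τ * F) = WeierstrassCurve.Affine.Point.map (W' := (W.localMinimalIntegralModel v).map (algebraMap (v.adicCompletionIntegers K) (v.adicCompletion K))) ((absoluteGaloisGroup.toAlgEquiv (v.adicCompletion K) (τ) : AlgebraicClosure (v.adicCompletion K) ≃ₐ[v.adicCompletion K] AlgebraicClosure (v.adicCompletion K)) : AlgebraicClosure (v.adicCompletion K) →ₐ[v.adicCompletion K] AlgebraicClosure (v.adicCompletion K)) (g F) := by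
      rw [hg, hI τ hτ, zero_add]
    have h2 : g (F * (F⁻¹ * τ * F)) = g F := by rw [hg, hI _ hτ', map_zero, add_zero]
    rw [← h1, show τ * F = F * (F⁻¹ * τ * F) by group, h2]
  -- an `m` with `g (F^m) = 0` and `φ^[m] = id`
  have hS₁ : {σ | g σ = 0} ∈ 𝓝 (1 : absoluteGaloisGroup (v.adicCompletion K)) := hopen.mem_nhds (cocycle_apply_one hg)
  haveI := isGalois_algebraicClosure_adicCompletion (v := v)
  obtain ⟨L₀, hL₀fin, hL₀normal, hL₀sub⟩ :=
    (krullTopology_mem_nhds_one_iff_of_normal (v.adicCompletion K) (AlgebraicClosure (v.adicCompletion K)) {σ | g σ = 0}).mp hS₁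
  haveI := hL₀fin
  haveI := hL₀normal
  set m₀ : ℕ := orderOf (AlgEquiv.restrictNormalHom L₀ ((absoluteGaloisGroup.toAlgEquiv (v.adicCompletion K)) F)) with hm₀def
  have hFpow : ∀ k : ℕ, g (F ^ (m₀ * k)) = 0 := by
    intro k
    apply hL₀sub
    change ((absoluteGaloisGroup.toAlgEquiv (v.adicCompletion K)) (F ^ (m₀ * k)) : (AlgebraicClosure (v.adicCompletion K)) ≃ₐ[(v.adicCompletion K)] (AlgebraicClosure (v.adicCompletion K))) ∈ (L₀.fixingSubgroup : Set ((AlgebraicClosure (v.adicCompletion K)) ≃ₐ[(v.adicCompletion K)] (AlgebraicClosure (v.adicCompletion K))))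
    rw [SetLike.mem_coe, ← IntermediateField.restrictNormalHom_ker, MonoidHom.mem_ker, map_pow, map_pow,
      pow_mul, pow_orderOf_eq_one, one_pow]
  set m : ℕ := m₀ * r with hmdef
  have hgFm : g (F ^ m) = 0 := hFpow r
  have hφm : ∀ x, φ^[m] x = x := fun x ↦ by
    rw [hmdef, mul_comm, Function.iterate_mul]
    induction m₀ with
    | zero => rfl
    | succ k ih => rw [Function.iterate_succ_apply', ih, hr]
  -- the norm of `ā` vanishes
  have hNa : ∑ j ∈ Finset.range m, φ^[j] (QuotientAddGroup.mk (⟨g F, haN⟩ : N)) = 0 := by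
    have h1 : ∑ j ∈ Finset.range m, φ^[j] (QuotientAddGroup.mk (⟨g F, haN⟩ : N)) =
        QuotientAddGroup.mk' L (∑ j ∈ Finset.range m, φN^[j] (⟨g F, haN⟩ : N)) := by
      rw [map_sum (QuotientAddGroup.mk' L)]
      exact Finset.sum_congr rfl fun j _ ↦ hφ_iter j _
    rw [h1]
    have h2 : (∑ j ∈ Finset.range m, φN^[j] (⟨g F, haN⟩ : N) : N) = 0 := by
      apply Subtype.ext
      rw [AddSubgroup.val_finsetSum, AddSubgroup.coe_zero, ← hgFm, cocycle_apply_pow hg F m]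
      exact Finset.sum_congr rfl fun j _ ↦ hφN_iter j _
    rw [h2, map_zero]
  -- Herbrand
  have hHerb := card_ker_sub_id_nsmul_mem_range φ hφm hNa
  -- `#ker(φ − id) = c_v`: the map `ψ : X(K_v) → Φ̃`
  have hXid : ((W.localMinimalIntegralModel v).map (algebraMap (v.adicCompletionIntegers K) (v.adicCompletion K))).baseChange (v.adicCompletion K) = ((W.localMinimalIntegralModel v).map (algebraMap (v.adicCompletionIntegers K) (v.adicCompletion K))) := by
    change ((W.localMinimalIntegralModel v).map (algebraMap (v.adicCompletionIntegers K) (v.adicCompletion K))).map (algebraMap (v.adicCompletion K) (v.adicCompletion K)) = _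
    rw [Algebra.algebraMap_self, WeierstrassCurve.map_id]
  set ofId := WeierstrassCurve.Affine.Point.map (W' := ((W.localMinimalIntegralModel v).map (algebraMap (v.adicCompletionIntegers K) (v.adicCompletion K))))
    (Algebra.ofId (v.adicCompletion K) (AlgebraicClosure (v.adicCompletion K))) with hofId
  have hcompσ : ∀ σ : absoluteGaloisGroup (v.adicCompletion K),
      (((absoluteGaloisGroup.toAlgEquiv (v.adicCompletion K) σ : AlgebraicClosure (v.adicCompletion K) ≃ₐ[v.adicCompletion K] AlgebraicClosure (v.adicCompletion K)) : AlgebraicClosure (v.adicCompletion K) →ₐ[v.adicCompletion K] AlgebraicClosure (v.adicCompletion K))).comp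
        (Algebra.ofId (v.adicCompletion K) (AlgebraicClosure (v.adicCompletion K))) =
        Algebra.ofId (v.adicCompletion K) (AlgebraicClosure (v.adicCompletion K)) := fun σ ↦ by
    ext
  have hofId_fix : ∀ (σ : absoluteGaloisGroup (v.adicCompletion K)) (R : (((W.localMinimalIntegralModel v).map (algebraMap (v.adicCompletionIntegers K) (v.adicCompletion K))).baseChange (v.adicCompletion K)).toAffine.Point),
      WeierstrassCurve.Affine.Point.map (W' := (W.localMinimalIntegralModel v).map (algebraMap (v.adicCompletionIntegers K) (v.adicCompletion K))) ((absoluteGaloisGroup.toAlgEquiv (v.adicCompletion K) (σ) : AlgebraicClosure (v.adicCompletion K) ≃ₐ[v.adicCompletion K] AlgebraicClosure (v.adicCompletion K)) : AlgebraicClosure (v.adicCompletion K) →ₐ[v.adicCompletion K] AlgebraicClosure (v.adicCompletion K)) (ofId R) = ofId R := by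
    intro σ R
    rw [hofId, WeierstrassCurve.Affine.Point.map_map, hcompσ]
  have hofId_N : ∀ R, ofId R ∈ N := fun R ↦ (hNmem _).mpr fun τ _ ↦ hofId_fix τ R
  set ψ : (((W.localMinimalIntegralModel v).map (algebraMap (v.adicCompletionIntegers K) (v.adicCompletion K))).baseChange (v.adicCompletion K)).toAffine.Point →+ N ⧸ L :=
    (QuotientAddGroup.mk' L).comp (ofId.codRestrict N hofId_N) with hψdef
  have hψ : ∀ R, ψ R = QuotientAddGroup.mk (⟨ofId R, hofId_N R⟩ : N) := fun _ ↦ rfl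
  set E₀K := (W.localMinimalIntegralModel v).nonsingularReductionSubgroup
    (integers_valuationRing_valuation (v.adicCompletionIntegers K) (v.adicCompletion K)) with hE₀K
  -- kernel of `ψ`
  have hψker : ψ.ker = E₀K.comap (Affine.Point.congrEquiv hXid).toAddMonoidHom := by
    ext R
    rw [AddMonoidHom.mem_ker, hψ, QuotientAddGroup.eq_zero_iff, hLdef, AddSubgroup.mem_addSubgroupOf,
      AddSubgroup.mem_comap, hE₀K, mem_nonsingularReductionSubgroup_iff]
    change ofId R ∈ N₀ ↔ (W.localMinimalIntegralModel v).HasNonsingularReduction (Affine.Point.congrEquiv hXid R)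
    rw [hN₀]
    rcases R with _ | ⟨x₀, y₀, h⟩
    · rw [← WeierstrassCurve.Affine.Point.zero_def, map_zero, map_zero, map_zero]
      exact iff_of_true WeierstrassCurve.hasNonsingularReduction_zero WeierstrassCurve.hasNonsingularReduction_zero
    · rw [hofId, Affine.Point.map_some, Affine.Point.congrEquiv_some, Affine.Point.congrEquiv_some]
      exact hasNonsingularReduction_algebraMap_iff hw (W.localMinimalIntegralModel v) h𝔐 hX _ _
  -- range of `ψ` = fixed points of `φ`
  have hψrange : ψ.range = (φ - AddMonoidHom.id _).ker := by
    ext x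
    constructor
    · rintro ⟨R, rfl⟩
      rw [AddMonoidHom.mem_ker, AddMonoidHom.sub_apply, AddMonoidHom.id_apply, sub_eq_zero, hψ, hφmk]
      apply congrArg
      apply Subtype.ext
      rw [hφN_coe, hgalF]
      exact hofId_fix F R
    · intro hx
      induction x using QuotientAddGroup.induction_on with
      | H P =>
        rw [AddMonoidHom.mem_ker, AddMonoidHom.sub_apply, AddMonoidHom.id_apply, sub_eq_zero, hφmk,
          QuotientAddGroup.eq, hLdef, AddSubgroup.mem_addSubgroupOf] at hx
        -- `F P - P ∈ N₀`
        have hx' : galF (P : ((((W.localMinimalIntegralModel v).map (algebraMap (v.adicCompletionIntegers K) (v.adicCompletion K))).baseChange (AlgebraicClosure (v.adicCompletion K)))).toAffine.Point) - P ∈ N₀ := by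
          have : (((-φN P + P : N) : N) : ((((W.localMinimalIntegralModel v).map (algebraMap (v.adicCompletionIntegers K) (v.adicCompletion K))).baseChange (AlgebraicClosure (v.adicCompletion K)))).toAffine.Point) = -(galF (P : ((((W.localMinimalIntegralModel v).map (algebraMap (v.adicCompletionIntegers K) (v.adicCompletion K))).baseChange (AlgebraicClosure (v.adicCompletion K)))).toAffine.Point) - P) := by
            simp only [AddSubgroup.coe_add, AddSubgroup.coe_neg, hφN_coe]; abel
          rw [this, neg_mem_iff] at hx
          exact hx
        obtain ⟨y, hyfix, hyE⟩ := exists_fixed_sub_mem_E0_of_bad W hw hι hbad h𝔐 hF (P : ((((W.localMinimalIntegralModel v).map (algebraMap (v.adicCompletionIntegers K) (v.adicCompletion K))).baseChange (AlgebraicClosure (v.adicCompletion K)))).toAffine.Point) P.2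
          ((hN₀ _).mp (by rw [hgalF] at hx'; exact hx'))
        obtain ⟨R, hR⟩ := exists_point_map_eq_of_forall_map_eq _ hyfix
        refine ⟨R, ?_⟩
        rw [hψ, QuotientAddGroup.eq, hLdef, AddSubgroup.mem_addSubgroupOf]
        have hy : ofId R = y := hR
        have : (((-⟨ofId R, hofId_N R⟩ + P : N) : N) : ((((W.localMinimalIntegralModel v).map (algebraMap (v.adicCompletionIntegers K) (v.adicCompletion K))).baseChange (AlgebraicClosure (v.adicCompletion K)))).toAffine.Point) = (P : ((((W.localMinimalIntegralModel v).map (algebraMap (v.adicCompletionIntegers K) (v.adicCompletion K))).baseChange (AlgebraicClosure (v.adicCompletion K)))).toAffine.Point) - y := by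
          simp only [AddSubgroup.coe_add, AddSubgroup.coe_neg, hy]; abel
        rw [this]
        exact (hN₀ _).mpr hyE
  have hcard : Nat.card ((φ - AddMonoidHom.id _).ker) = ((W.baseChange (v.adicCompletion K)).localTamagawaNumber (v.adicCompletionIntegers K)) := by
    rw [← hψrange, ← AddSubgroup.index_ker, hψker,
      AddSubgroup.index_comap_of_surjective _ (Affine.Point.congrEquiv hXid).surjective, hE₀K]
    exact (localTamagawaNumber_eq_index_nonsingularReductionSubgroup (W := W) (v := v)).symm
  rw [hcard] at hHerb
  -- unpack: `c • a = (F Q - Q) + e`, `e ∈ N₀`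
  obtain ⟨Qbar, hQbar⟩ := hHerb
  induction Qbar using QuotientAddGroup.induction_on with
  | H Q =>
    rw [AddMonoidHom.sub_apply, AddMonoidHom.id_apply, hφmk, ← QuotientAddGroup.mk_sub, ← QuotientAddGroup.mk_nsmul,
      QuotientAddGroup.eq, hLdef, AddSubgroup.mem_addSubgroupOf] at hQbar
    set e : ((((W.localMinimalIntegralModel v).map (algebraMap (v.adicCompletionIntegers K) (v.adicCompletion K))).baseChange (AlgebraicClosure (v.adicCompletion K)))).toAffine.Point := ((W.baseChange (v.adicCompletion K)).localTamagawaNumber (v.adicCompletionIntegers K)) • g F - (galF (Q : ((((W.localMinimalIntegralModel v).map (algebraMap (v.adicCompletionIntegers K) (v.adicCompletion K))).baseChange (AlgebraicClosure (v.adicCompletion K)))).toAffine.Point) - Q) with hedef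
    have heN₀ : e ∈ N₀ := by
      have : (((-(φN Q - Q) + ((W.baseChange (v.adicCompletion K)).localTamagawaNumber (v.adicCompletionIntegers K)) • (⟨g F, haN⟩ : N) : N) : N) : ((((W.localMinimalIntegralModel v).map (algebraMap (v.adicCompletionIntegers K) (v.adicCompletion K))).baseChange (AlgebraicClosure (v.adicCompletion K)))).toAffine.Point) = e := by
        simp only [AddSubgroup.coe_add, AddSubgroup.coe_neg, AddSubgroup.coe_sub, AddSubgroup.coe_nsmul, hφN_coe, hedef]
        abel
      rw [this] at hQbar; exact hQbar
    -- the corrected cocycle `g' = c • g - ∂Q`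
    let gc : absoluteGaloisGroup (v.adicCompletion K) → ((((W.localMinimalIntegralModel v).map (algebraMap (v.adicCompletionIntegers K) (v.adicCompletion K))).baseChange (AlgebraicClosure (v.adicCompletion K)))).toAffine.Point := fun σ ↦ ((W.baseChange (v.adicCompletion K)).localTamagawaNumber (v.adicCompletionIntegers K)) • g σ
    have hgcapp : ∀ σ, gc σ = ((W.baseChange (v.adicCompletion K)).localTamagawaNumber (v.adicCompletionIntegers K)) • g σ := fun _ ↦ rfl
    have hgc : ∀ σ τ, gc (σ * τ) = gc σ + WeierstrassCurve.Affine.Point.map (W' := (W.localMinimalIntegralModel v).map (algebraMap (v.adicCompletionIntegers K) (v.adicCompletion K))) ((absoluteGaloisGroup.toAlgEquiv (v.adicCompletion K) (σ) : AlgebraicClosure (v.adicCompletion K) ≃ₐ[v.adicCompletion K] AlgebraicClosure (v.adicCompletion K)) : AlgebraicClosure (v.adicCompletion K) →ₐ[v.adicCompletion K] AlgebraicClosure (v.adicCompletion K)) (gc τ) := fun σ τ ↦ by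
      rw [hgcapp, hgcapp, hgcapp, hg σ τ, nsmul_add, map_nsmul]
    have hopenc : IsOpen {σ | gc σ = 0} := by
      refine isOpen_setOf_eq_zero_of_mem_nhds hgc (Filter.mem_of_superset hS₁ fun σ hσ ↦ ?_)
      simp only [Set.mem_setOf_eq] at hσ ⊢
      rw [hgcapp, hσ, nsmul_zero]
    let g' : absoluteGaloisGroup (v.adicCompletion K) → ((((W.localMinimalIntegralModel v).map (algebraMap (v.adicCompletionIntegers K) (v.adicCompletion K))).baseChange (AlgebraicClosure (v.adicCompletion K)))).toAffine.Point :=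
      fun σ ↦ gc σ - (WeierstrassCurve.Affine.Point.map (W' := (W.localMinimalIntegralModel v).map (algebraMap (v.adicCompletionIntegers K) (v.adicCompletion K))) ((absoluteGaloisGroup.toAlgEquiv (v.adicCompletion K) (σ) : AlgebraicClosure (v.adicCompletion K) ≃ₐ[v.adicCompletion K] AlgebraicClosure (v.adicCompletion K)) : AlgebraicClosure (v.adicCompletion K) →ₐ[v.adicCompletion K] AlgebraicClosure (v.adicCompletion K)) Q - Q)
    have hg'app : ∀ σ, g' σ = gc σ - (WeierstrassCurve.Affine.Point.map (W' := (W.localMinimalIntegralModel v).map (algebraMap (v.adicCompletionIntegers K) (v.adicCompletion K))) ((absoluteGaloisGroup.toAlgEquiv (v.adicCompletion K) (σ) : AlgebraicClosure (v.adicCompletion K) ≃ₐ[v.adicCompletion K] AlgebraicClosure (v.adicCompletion K)) : AlgebraicClosure (v.adicCompletion K) →ₐ[v.adicCompletion K] AlgebraicClosure (v.adicCompletion K)) Q - Q) := fun _ ↦ rfl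
    have hg' : ∀ σ τ, g' (σ * τ) = g' σ + WeierstrassCurve.Affine.Point.map (W' := (W.localMinimalIntegralModel v).map (algebraMap (v.adicCompletionIntegers K) (v.adicCompletion K))) ((absoluteGaloisGroup.toAlgEquiv (v.adicCompletion K) (σ) : AlgebraicClosure (v.adicCompletion K) ≃ₐ[v.adicCompletion K] AlgebraicClosure (v.adicCompletion K)) : AlgebraicClosure (v.adicCompletion K) →ₐ[v.adicCompletion K] AlgebraicClosure (v.adicCompletion K)) (g' τ) := cocycle_sub_coboundary hgc (Q : ((((W.localMinimalIntegralModel v).map (algebraMap (v.adicCompletionIntegers K) (v.adicCompletion K))).baseChange (AlgebraicClosure (v.adicCompletion K)))).toAffine.Point)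
    have hopen' : IsOpen {σ | g' σ = 0} := isOpen_setOf_sub_coboundary_eq_zero hgc hopenc (Q : ((((W.localMinimalIntegralModel v).map (algebraMap (v.adicCompletionIntegers K) (v.adicCompletion K))).baseChange (AlgebraicClosure (v.adicCompletion K)))).toAffine.Point)
    have hI' : ∀ τ ∈ 𝔐.inertia (absoluteGaloisGroup (v.adicCompletion K)), g' τ = 0 := fun τ hτ ↦ by
      rw [hg'app, hgcapp, hI τ hτ, nsmul_zero, Q.2 τ hτ, sub_self, sub_zero]
    have hg'F : g' F = e := by rw [hg'app, hgcapp, hedef]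
    have hφq : ∀ z : AlgebraicClosure (v.adicCompletion K), w z ≤ 1 →
        w (absoluteGaloisGroup.toAlgEquiv (v.adicCompletion K) F z -
          z ^ Nat.card (IsLocalRing.ResidueField (v.adicCompletionIntegers K))) < 1 :=
      fun z hz ↦ spectralValuation_frobenius_sub_pow_lt_one hw h𝔐 hF hz
    have heE : ((W.localMinimalIntegralModel v).map ι).HasNonsingularReduction
        (Affine.Point.congrEquiv (baseChange_map_eq_baseChange_map hι (W.localMinimalIntegralModel v)) (g' F)) := by rw [hg'F]; exact (hN₀ e).mp heN₀
    have hlift' : ∃ b : ((((W.localMinimalIntegralModel v).map (algebraMap (v.adicCompletionIntegers K) (v.adicCompletion K))).baseChange (AlgebraicClosure (v.adicCompletion K)))).toAffine.Point,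
        (∀ τ ∈ 𝔐.inertia (absoluteGaloisGroup (v.adicCompletion K)),
          WeierstrassCurve.Affine.Point.map (W' := (W.localMinimalIntegralModel v).map (algebraMap (v.adicCompletionIntegers K) (v.adicCompletion K))) ((absoluteGaloisGroup.toAlgEquiv (v.adicCompletion K) (τ) : AlgebraicClosure (v.adicCompletion K) ≃ₐ[v.adicCompletion K] AlgebraicClosure (v.adicCompletion K)) : AlgebraicClosure (v.adicCompletion K) →ₐ[v.adicCompletion K] AlgebraicClosure (v.adicCompletion K)) b = b) ∧
        ((W.localMinimalIntegralModel v).map ι).HasNonsingularReduction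
        (Affine.Point.congrEquiv (baseChange_map_eq_baseChange_map hι (W.localMinimalIntegralModel v)) (b)) ∧
        g' F - (WeierstrassCurve.Affine.Point.map (W' := (W.localMinimalIntegralModel v).map (algebraMap (v.adicCompletionIntegers K) (v.adicCompletion K))) ((absoluteGaloisGroup.toAlgEquiv (v.adicCompletion K) (F) : AlgebraicClosure (v.adicCompletion K) ≃ₐ[v.adicCompletion K] AlgebraicClosure (v.adicCompletion K)) : AlgebraicClosure (v.adicCompletion K) →ₐ[v.adicCompletion K] AlgebraicClosure (v.adicCompletion K)) b - b) ∈ kernel w (((W.localMinimalIntegralModel v).map (algebraMap (v.adicCompletionIntegers K) (v.adicCompletion K))).baseChange (AlgebraicClosure (v.adicCompletion K))) := by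
      rcases hbad with hm | ha
      · exact exists_lift_sub_mem_kernel_of_hasMultiplicativeReductionAt_mem_E0 W hw hm h𝔐 hι hφq (g' F) heE
      · exact exists_lift_sub_mem_kernel_of_hasAdditiveReductionAt_mem_E0 hw hι W ha h𝔐 hφq (g' F) heE
    obtain ⟨P', -, hP'⟩ := exists_mem_E0_eq_map_sub_of_cocycle_of_lift W hw hι h𝔐 hF g' hg' hopen' hI' hlift'
    refine ⟨(Q : ((((W.localMinimalIntegralModel v).map (algebraMap (v.adicCompletionIntegers K) (v.adicCompletion K))).baseChange (AlgebraicClosure (v.adicCompletion K)))).toAffine.Point) + P', fun σ ↦ ?_⟩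
    have h := hP' σ
    rw [hg'app, hgcapp, sub_eq_iff_eq_add] at h
    rw [map_add, h]
    abel

end Summit.BirchSwinnertonDyer.BirchSwinnertonDyer.Theorems.MilneTamagawa

end
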